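import Mathlib.Analysis.Complex.Liouville
import Mathlib.Analysis.Complex.RealDeriv
import Mathlib.Analysis.SpecialFunctions.Integrals.Basic
import Literature.MathematicalPhysics.QuantumFieldTheory.Balaban1983to89.B12Taylor334

/-!
# `Balaban1983to89.B12CauchyRemainder354` — [Balaban1987RG1] (3.54) p. 280 (⇒ the bound "of the form (3.35)",
p. 277): the Cauchy estimate of the fifth-order remainder of the fundamental expansion (3.34)

HONEST FRAMING (cell `lit-balaban`, verbatim): statement-level skeleton of published theorems with citation tags; proofs where landed; nothing here is a claim about the Yang–Mills mass gap.

CITATION HEADER.  T. Bałaban, *Renormalization group approach to lattice gauge field theories. I. Generation of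
effective actions in a small field approximation and a coupling constant renormalization in four dimensions*,
Commun. Math. Phys. **109** (1987) 249–301, doi:10.1007/bf01215223 [Balaban1987RG1] (cell paper B12; held text
`paper:balaban1987-cmp109-rg-i-small-field`, journal page = PDF page + 248; the displays below were read as images
from the page renders `b2b-balaban-ref1/pages/1987-cmp109-rg-I-small-field/…-p029-x2.png` (p. 277) and
`…-p032-x2.png` (p. 280)).  Unit `lit-balaban-r20` (fold owner of B12), SKELETON rows `B12.Eq3.54` (this file's
decl of record `ineq354`, literal form `remainder334_norm_le`) and `B12.Eq3.35` (`ineq335_of_354`); the expansion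
(3.34) itself is row `B12.Eq3.33-3.34` = `B12Taylor334.taylor334` (unit `lit-balaban-r09`), Lemma 4 / (3.53) is
`B12Sec2to5.Lemma4Printed`, the inductive bound (1.18) is `B12.Ineq118`.  v1.1 (§5) adds the companion first-order
Cauchy step of the same section: rows `B12.Eq3.15` ((3.15) p. 273, the `t_□`-derivative as a Cauchy integral:
`deriv_eq_circleIntegral_315`) and `B12.Eq3.17` ((3.17): `ineq317` = |(3.15)| ≤ (1/r)E₀exp(−κd_j(X)),
`ineq317_chain`/`ineq317_printed` = the second inequality from the radius equality and (3.9); the constant bookkeeping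
alone was `B12Sec2to5.const317`).

WHAT IS PRINTED.  p. 277 [PDF 29], after (3.34): *«Let us consider the last term in the expansion (3.34). By the
definiton of B and by the inequalities (3.32) we have |B| < O(1)L^jη, hence we expect that this term can be bounded by
    O(1) exp(−κd_j(X)) (O(1)L^jη)⁵.   (3.35)
To prove this statement we have to go into rather lengthy considerations. The main problem is to investigate
analyticity properties of this term on proper spaces. […] We have to prove that
    (U_j(□₀, exp iτB), J_j(□₀, exp iτB))|_X ∈ U^c_j(X, α₀, α₁)   (3.36)
for all 𝐔, 𝐉, 𝐀 in the above spaces, and for the parameters τ in the interval [0, 1]. We will prove a stronger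
statement, which will allow us eventually to get the bound (3.35). The analyticity of the functions in (3.34) follows
from the analyticity of the two functions in (3.36), and the assumed analyticity of 𝐄^{(j)}(X, 𝐔, 𝐉) on the space
U^c_j(X, α₀, α₁).»*  The stronger statement is **Lemma 4** p. 280 [PDF 32] (for |B′| < α₃ the configuration built on
exp i(τB + B′) lies in U^c_j(X, α₀, α₁), and the functions are analytic), after which, verbatim:
*«Let us consider the last term in (3.34). We want to bound it by an expression of the form (3.35). We have
    | ∫₀¹ dτ ((1 − τ)⁴/4!) ⟨(δ⁵/δB⁵) 𝐄^{(j)}(X, U_j(□₀, exp iτB)), ⊗⁵ B⟩ |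
      ≦ sup_{τ∈[0,1]} | ∫_{|σ|=r} dσ (1/σ⁶) 𝐄^{(j)}(X, U_j(□₀, exp i(τB + σB))) |
      ≦ E₀ α₃⁻⁵ |B|⁵ exp(−κd_j(X)).   (3.54)
Because |B| < O(1)L^jη, e.g. |B| < α₁L^jη, hence we have the required bound. In fact we have to be more careful,
because this bound holds on □̃⁴ only. […]»*

THE ARGUMENT, AS PRINTED, AND HOW IT IS FORMALIZED.  Fix 𝐔, 𝐀 (hence B) and X.  By Lemma 4 and (1.18) the function
`Φ(z) := 𝐄^{(j)}(X, U_j(□₀, exp izB))` of ONE complex variable is analytic and bounded by `M := E₀ exp(−κd_j(X))` for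
`z = τ + σ`, `τ ∈ [0,1]`, `|σ| < r := α₃/|B|` (so that |σB| < α₃).  The integrand of the last term of (3.34) is
`((1 − τ)⁴/4!) Φ⁽⁵⁾(τ)` (chain rule along the ray, `B12Taylor334.iteratedDeriv_comp_ray`, and real = complex
derivative for the restriction of an analytic function, `iteratedDeriv_comp_ofReal` below).  Cauchy's formula for the
fifth derivative on the circle |σ| = ρ < r (the middle member of (3.54); `iteratedDeriv_five_eq_circleIntegral`) and
Cauchy's estimate give `‖Φ⁽⁵⁾(τ)‖ ≤ 5! M ρ⁻⁵`, hence `≤ 5! M r⁻⁵` letting ρ ↑ r (`norm_iteratedDeriv_le_of_ball`), and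
`∫₀¹ (1 − τ)⁴/4! dτ = 1/5!` yields `‖last term of (3.34)‖ ≤ M r⁻⁵ = E₀ α₃⁻⁵ |B|⁵ exp(−κd_j(X))` — the right member of
(3.54) (`ineq354`, printed constants `ineq354_printed`; literal left member `remainder334_norm_le`,
`remainder334_norm_le_printed`; with (3.34): `taylor5_remainder_norm_le`).  With |B| ≤ C·L^jη this is the bound of
the form (3.35) with O(1) = E₀α₃⁻⁵ and O(1) = C (`ineq335_of_354`).  Everything is PROVED (Mathlib:
`Complex.norm_iteratedDeriv_le_of_forall_mem_sphere_norm_le`, `DiffContOnCl.circleIntegral_one_div_sub_center_pow_smul`,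
`intervalIntegral.norm_integral_le_of_norm_le`, `integral_pow`); no carrier of the cell is needed: the hypotheses are
exactly the two inputs the print names (analyticity on the (3.36)/(3.53) parameter domain and the sup bound (1.18)),
stated for an abstract `Φ`.  The localization caveat («this bound holds on □̃⁴ only …») and the final remark on the
constant are NOT formalized here (they concern the later summations, rows `B12.Txt@281`, `B12.Eq4.3`).

TRANSCRIPT NOTES.  (T1) The render prints `sup_{r∈[0,1]}` under the sup and `|σ| = r` under the contour; the sup
variable is τ (the integration variable of the left member), the contour radius is r = α₃|B|⁻¹ (so that B′ = σB has
|B′| < α₃ as Lemma 4 requires) — we read `sup_{τ∈[0,1]}`.  (T2) The middle member is printed without the Cauchy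
normalization: ⟨δ⁵𝐄/δB⁵(… exp iτB), ⊗⁵B⟩ = Φ⁽⁵⁾(τ) = (5!/2πi)∮_{|σ|=ρ} σ⁻⁶ Φ(τ + σ) dσ and ∫₀¹(1 − τ)⁴/4! dτ = 1/5!,
so the left member is ≤ sup_τ |(1/2πi)∮ σ⁻⁶ Φ(τ+σ) dσ| ≤ (1/2π)·2πρ·ρ⁻⁶·M = Mρ⁻⁵; read literally (without 1/2πi) the
first printed `≦` holds with room 1/2π and the second needs the factor 2π back — the END-TO-END inequality
left ≦ right of (3.54) is exactly `ineq354`, and we record the middle member as the identity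
`iteratedDeriv_five_eq_circleIntegral` (normalized).  (T3) Lemma 4 gives analyticity for |B′| < α₃ (OPEN ball), so
the contour must have radius ρ < r = α₃/|B|; the printed right member with α₃⁻⁵ exactly is recovered in the limit
ρ ↑ r (`norm_iteratedDeriv_le_of_ball`), no continuity on the closed ball being assumed.  (T4) "definiton" [sic] p. 277.
-/

namespace Literature.MathematicalPhysics.QuantumFieldTheory.Balaban1983to89.B12CauchyRemainder354

open Set Filter Metric Complex
open scoped Topology Nat Real

variable {F : Type*} [NormedAddCommGroup F] [NormedSpace ℂ F] [CompleteSpace F]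

/-! ## 1. Cauchy's estimate from a sup bound on an OPEN disc (the limit ρ ↑ r of (T3)) -/

/-- Cauchy's estimate with the sharp radius from a bound on the OPEN disc: if `Φ` is holomorphic on `ball c r` and
`‖Φ‖ ≤ M` there, then `‖Φ⁽ⁿ⁾(c)‖ ≤ n! M / rⁿ` (Cauchy on every circle of radius ρ < r, then ρ ↑ r).  This is the step
«≦ E₀α₃⁻⁵|B|⁵exp(−κd_j(X))» of (3.54) with the printed constant exactly.
[cite: Balaban1987RG1, (3.54) p.280] (elementary API for (3.54): Cauchy's inequality) -/
theorem norm_iteratedDeriv_le_of_ball {Φ : ℂ → F} {c : ℂ} {r M : ℝ} (hr : 0 < r)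
    (hΦ : DifferentiableOn ℂ Φ (ball c r)) (hM : ∀ z ∈ ball c r, ‖Φ z‖ ≤ M) (n : ℕ) :
    ‖iteratedDeriv n Φ c‖ ≤ n ! * M / r ^ n := by
  -- Cauchy on the circle of radius ρ, for every 0 < ρ < r
  have hρ : ∀ ρ : ℝ, 0 < ρ → ρ < r → ‖iteratedDeriv n Φ c‖ ≤ n ! * M / ρ ^ n := by
    intro ρ hρ0 hρr
    have hsub : closedBall c ρ ⊆ ball c r := closedBall_subset_ball hρr
    have hdc : DiffContOnCl ℂ Φ (ball c ρ) :=
      ⟨hΦ.mono (ball_subset_ball hρr.le),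
        (hΦ.mono (closure_ball_subset_closedBall.trans hsub)).continuousOn⟩
    exact Complex.norm_iteratedDeriv_le_of_forall_mem_sphere_norm_le n hρ0 hdc
      fun z hz => hM z (hsub (sphere_subset_closedBall hz))
  -- let ρ ↑ r
  have hcont : ContinuousAt (fun ρ : ℝ => (n ! : ℝ) * M / ρ ^ n) r :=
    continuousAt_const.div (continuousAt_id.pow n) (by simpa using pow_ne_zero n hr.ne')
  have htend : Tendsto (fun ρ : ℝ => (n ! : ℝ) * M / ρ ^ n) (𝓝[<] r) (𝓝 ((n ! : ℝ) * M / r ^ n)) :=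
    hcont.tendsto.mono_left nhdsWithin_le_nhds
  refine ge_of_tendsto htend ?_
  have h2 : ∀ᶠ ρ in 𝓝[<] r, 0 < ρ := eventually_nhdsWithin_of_eventually_nhds (lt_mem_nhds hr)
  filter_upwards [eventually_mem_nhdsWithin, h2] with ρ hρr hρ0
  exact hρ ρ hρ0 hρr

/-- The middle member of (3.54), normalized (transcript note (T2)): Cauchy's formula for the fifth derivative,
`Φ⁽⁵⁾(c) = 5!·(2πi)⁻¹ ∮_{|z−c|=ρ} (z − c)⁻⁶ Φ(z) dz` for `Φ` holomorphic on `ball c r`, `0 < ρ < r`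
(in the paper `c = τ`, `z − c = σ`, `Φ(z) = 𝐄^{(j)}(X, U_j(□₀, exp i(τB + σB)))`).
[cite: Balaban1987RG1, (3.54) p.280] -/
theorem iteratedDeriv_five_eq_circleIntegral {Φ : ℂ → F} {c : ℂ} {r ρ : ℝ} (hρ : 0 < ρ) (hρr : ρ < r)
    (hΦ : DifferentiableOn ℂ Φ (ball c r)) :
    iteratedDeriv 5 Φ c = ((5 ! : ℕ) : ℂ) • (2 * π * I)⁻¹ • ∮ z in C(c, ρ), (1 / (z - c) ^ 6) • Φ z := by
  have hsub : closedBall c ρ ⊆ ball c r := closedBall_subset_ball hρr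
  have hdc : DiffContOnCl ℂ Φ (ball c ρ) :=
    ⟨hΦ.mono (ball_subset_ball hρr.le),
      (hΦ.mono (closure_ball_subset_closedBall.trans hsub)).continuousOn⟩
  rw [hdc.circleIntegral_one_div_sub_center_pow_smul hρ 5, smul_smul, smul_smul]
  have h5 : ((5 ! : ℕ) : ℂ) ≠ 0 := by exact_mod_cast Nat.factorial_ne_zero 5
  have h2pi : (2 * π * I : ℂ) ≠ 0 := two_pi_I_ne_zero
  rw [show ((5 ! : ℕ) : ℂ) * (2 * π * I)⁻¹ * (2 * π * I / ((5 ! : ℕ) : ℂ)) = 1 by field_simp, one_smul]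

/-! ## 2. Real derivatives of the restriction of a holomorphic function to the real axis -/

omit [CompleteSpace F] in
/-- If `Ψ` has complex derivative `Ψ'` at the real point `t`, its restriction to `ℝ` has (real) derivative `Ψ'` at `t`
(vector-valued version of Mathlib's `HasDerivAt.comp_ofReal`).
[cite: Balaban1987RG1, (3.54) p.280] (elementary API for (3.54): the τ-derivatives in (3.34) are complex derivatives) -/
theorem hasDerivAt_comp_ofReal {Ψ : ℂ → F} {Ψ' : F} {t : ℝ} (h : HasDerivAt Ψ Ψ' (t : ℂ)) :
    HasDerivAt (fun s : ℝ => Ψ (s : ℂ)) Ψ' t := by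
  have h1 : HasDerivAt (fun s : ℝ => ((s : ℝ) : ℂ)) ((1 : ℝ) : ℂ) t := by
    simpa using (hasDerivAt_id t).ofReal_comp
  have h2 := HasDerivAt.scomp_of_eq t h h1 rfl
  simpa [Function.comp_def] using h2

/-- For `Ψ` holomorphic on an open set `S ⊆ ℂ` and a real point `t` with `↑t ∈ S`, the `n`-th REAL derivative of the
restriction `s ↦ Ψ(↑s)` at `t` is the `n`-th complex derivative `Ψ⁽ⁿ⁾(↑t)` (induction on `n`: derivatives of
holomorphic functions are holomorphic, and iterated derivatives only see germs).
[cite: Balaban1987RG1, (3.54) p.280] (elementary API for (3.54)) -/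
theorem iteratedDeriv_comp_ofReal {S : Set ℂ} (hS : IsOpen S) (n : ℕ) :
    ∀ {Ψ : ℂ → F}, DifferentiableOn ℂ Ψ S →
      ∀ {t : ℝ}, (t : ℂ) ∈ S → iteratedDeriv n (fun s : ℝ => Ψ (s : ℂ)) t = iteratedDeriv n Ψ (t : ℂ) := by
  induction n with
  | zero => intro Ψ _ t _; simp
  | succ n ih =>
    intro Ψ hΨ t ht
    have hderΨ : DifferentiableOn ℂ (deriv Ψ) S := ((hΨ.analyticOnNhd hS).deriv).differentiableOn
    have hT : IsOpen ((fun s : ℝ => (s : ℂ)) ⁻¹' S) := hS.preimage Complex.continuous_ofReal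
    -- near `t` the real derivative of the restriction is the restriction of the complex derivative
    have hev : (deriv fun s : ℝ => Ψ (s : ℂ)) =ᶠ[𝓝 t] fun s : ℝ => deriv Ψ (s : ℂ) := by
      filter_upwards [hT.mem_nhds ht] with s hs
      exact (hasDerivAt_comp_ofReal ((hΨ.differentiableAt (hS.mem_nhds hs)).hasDerivAt)).deriv
    rw [iteratedDeriv_succ', iteratedDeriv_succ', Filter.EventuallyEq.iteratedDeriv_eq n hev]
    exact ih hderΨ ht

/-! ## 3. (3.54): the fifth-order remainder of (3.34) is bounded by `M r⁻⁵` -/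

/-- **(3.54)** p. 280 [PDF 32], end-to-end, in one complex variable along the ray.  Let `Φ` (in the paper
`Φ(z) = 𝐄^{(j)}(X, U_j(□₀, exp izB))`) be holomorphic on `ball τ r` with `‖Φ‖ ≤ M` there, for every `τ ∈ [0, 1]`
(the paper: Lemma 4 with B′ = σB, |σ| < r = α₃/|B|, and (1.18), M = E₀exp(−κd_j(X))).  Then the last term of (3.34),
`∫₀¹ dτ ((1 − τ)⁴/4!) Φ⁽⁵⁾(τ)`, has norm `≤ M / r⁵` (Cauchy: ‖Φ⁽⁵⁾(τ)‖ ≤ 5! M r⁻⁵, and ∫₀¹ (1 − τ)⁴/4! dτ = 1/5!).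
[cite: Balaban1987RG1, (3.54) p.280] -/
theorem ineq354 {Φ : ℂ → F} {r M : ℝ} (hr : 0 < r)
    (hΦ : ∀ τ ∈ Icc (0 : ℝ) 1, DifferentiableOn ℂ Φ (ball (τ : ℂ) r))
    (hM : ∀ τ ∈ Icc (0 : ℝ) 1, ∀ z ∈ ball (τ : ℂ) r, ‖Φ z‖ ≤ M) :
    ‖∫ τ in (0 : ℝ)..1, ((1 - τ) ^ 4 / (4 ! : ℝ)) • iteratedDeriv 5 Φ (τ : ℂ)‖ ≤ M / r ^ 5 := by
  -- pointwise Cauchy estimate for the fifth derivative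
  have h5 : ∀ τ ∈ Icc (0 : ℝ) 1, ‖iteratedDeriv 5 Φ (τ : ℂ)‖ ≤ 5 ! * M / r ^ 5 :=
    fun τ hτ => norm_iteratedDeriv_le_of_ball hr (hΦ τ hτ) (hM τ hτ) 5
  have hle : ‖∫ τ in (0 : ℝ)..1, ((1 - τ) ^ 4 / (4 ! : ℝ)) • iteratedDeriv 5 Φ (τ : ℂ)‖
      ≤ ∫ τ in (0 : ℝ)..1, (1 - τ) ^ 4 / (4 ! : ℝ) * (5 ! * M / r ^ 5) := by
    refine intervalIntegral.norm_integral_le_of_norm_le zero_le_one ?_ ?_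
    · refine Filter.Eventually.of_forall fun τ hτ => ?_
      have hτ' : τ ∈ Icc (0 : ℝ) 1 := Ioc_subset_Icc_self hτ
      have hw : 0 ≤ (1 - τ) ^ 4 / (4 ! : ℝ) := by
        have : 0 ≤ 1 - τ := by linarith [hτ'.2]
        positivity
      rw [norm_smul, Real.norm_of_nonneg hw]
      exact mul_le_mul_of_nonneg_left (h5 τ hτ') hw
    · exact (by fun_prop : Continuous fun τ : ℝ => (1 - τ) ^ 4 / (4 ! : ℝ) * (5 ! * M / r ^ 5)).intervalIntegrable _ _
  refine hle.trans (le_of_eq ?_)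
  -- ∫₀¹ (1 − τ)⁴ dτ = 1/5
  have hint : ∫ τ in (0 : ℝ)..1, (1 - τ) ^ 4 = 1 / 5 := by
    have h := intervalIntegral.integral_comp_sub_left (a := (0 : ℝ)) (b := 1) (fun x : ℝ => x ^ 4) (1 : ℝ)
    simp only [sub_self, sub_zero] at h
    rw [h, integral_pow]
    norm_num
  rw [intervalIntegral.integral_mul_const, intervalIntegral.integral_div, hint]
  have h4 : ((4 ! : ℕ) : ℝ) = 24 := by norm_num [Nat.factorial]
  have h5' : ((5 ! : ℕ) : ℝ) = 120 := by norm_num [Nat.factorial]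
  rw [h4, h5']
  field_simp
  ring

/-- **(3.54) with the printed constants**: radius `r = α₃/|B|` (so that `B′ = σB` has `|B′| < α₃`, Lemma 4) and
`M = E₀ exp(−κd_j(X))` ((1.18)) give `≦ E₀ α₃⁻⁵ |B|⁵ exp(−κd_j(X))`.  Here `nB` stands for the number `|B| > 0`
(the sup norm of the field B; for B = 0 the left member vanishes trivially).
[cite: Balaban1987RG1, (3.54) p.280] -/
theorem ineq354_printed {Φ : ℂ → F} {α₃ nB E₀ κ d : ℝ} (hα₃ : 0 < α₃) (hnB : 0 < nB)
    (hΦ : ∀ τ ∈ Icc (0 : ℝ) 1, DifferentiableOn ℂ Φ (ball (τ : ℂ) (α₃ / nB)))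
    (hM : ∀ τ ∈ Icc (0 : ℝ) 1, ∀ z ∈ ball (τ : ℂ) (α₃ / nB), ‖Φ z‖ ≤ E₀ * Real.exp (-(κ * d))) :
    ‖∫ τ in (0 : ℝ)..1, ((1 - τ) ^ 4 / (4 ! : ℝ)) • iteratedDeriv 5 Φ (τ : ℂ)‖
      ≤ E₀ * α₃⁻¹ ^ 5 * nB ^ 5 * Real.exp (-(κ * d)) := by
  have h := ineq354 (div_pos hα₃ hnB) hΦ hM
  refine h.trans (le_of_eq ?_)
  field_simp

/-- **(3.35)** p. 277 [PDF 29], the shape of the bound, from (3.54): *«By the definiton of B and by the inequalities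
(3.32) we have |B| < O(1)L^jη, hence we expect that this term can be bounded by O(1) exp(−κd_j(X)) (O(1)L^jη)⁵.
(3.35)»* / p. 280: *«Because |B| < O(1)L^jη, e.g. |B| < α₁L^jη, hence we have the required bound.»* — if a quantity
`R` obeys the right member of (3.54) and `|B| ≤ C·(L^jη)`, then `R ≤ (E₀α₃⁻⁵)·exp(−κd_j(X))·(C·L^jη)⁵`
(the two O(1)'s being E₀α₃⁻⁵ and C, e.g. C = α₁).
[cite: Balaban1987RG1, (3.35) p.277] -/
theorem ineq335_of_354 {R E₀ α₃ nB κ d C s : ℝ} (hE₀ : 0 ≤ E₀) (hα₃ : 0 < α₃) (hnB : 0 ≤ nB)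
    (h354 : R ≤ E₀ * α₃⁻¹ ^ 5 * nB ^ 5 * Real.exp (-(κ * d))) (hB : nB ≤ C * s) :
    R ≤ (E₀ * α₃⁻¹ ^ 5) * Real.exp (-(κ * d)) * (C * s) ^ 5 := by
  have hpow : nB ^ 5 ≤ (C * s) ^ 5 := pow_le_pow_left₀ hnB hB 5
  have hK : 0 ≤ E₀ * α₃⁻¹ ^ 5 * Real.exp (-(κ * d)) := by positivity
  calc R ≤ E₀ * α₃⁻¹ ^ 5 * nB ^ 5 * Real.exp (-(κ * d)) := h354
    _ = (E₀ * α₃⁻¹ ^ 5 * Real.exp (-(κ * d))) * nB ^ 5 := by ring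
    _ ≤ (E₀ * α₃⁻¹ ^ 5 * Real.exp (-(κ * d))) * (C * s) ^ 5 := mul_le_mul_of_nonneg_left hpow hK
    _ = (E₀ * α₃⁻¹ ^ 5) * Real.exp (-(κ * d)) * (C * s) ^ 5 := by ring

/-! ## 4. The literal left member of (3.54): the last term of (3.34) (`B12Taylor334`) -/

section Ray

variable {E : Type*} [NormedAddCommGroup E] [NormedSpace ℝ E]

/-- The integrand of the last term of (3.34) is the fifth complex derivative along the ray: for `f` (in the paper
`f(B) = 𝐄^{(j)}(X, U_j(□₀, exp iB))`) of class `C⁵` on an open set `s ∋ τB`, agreeing near the real point `τ` along the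
ray with a function `Φ` holomorphic on `ball τ r`, `⟨δ⁵f/δB⁵(τB), ⊗⁵B⟩ = Φ⁽⁵⁾(τ)`.
[cite: Balaban1987RG1, (3.34) p.277, (3.54) p.280] -/
theorem iteratedFDeriv_ray_eq_iteratedDeriv {s : Set E} (hs : IsOpen s) {f : E → F} (hf : ContDiffOn ℝ 5 f s) (B : E)
    {τ r : ℝ} (hr : 0 < r) (hτB : τ • B ∈ s) {Φ : ℂ → F} (hΦ : DifferentiableOn ℂ Φ (ball (τ : ℂ) r))
    (hagree : ∀ᶠ t : ℝ in 𝓝 τ, f (t • B) = Φ (t : ℂ)) :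
    iteratedFDeriv ℝ 5 f (τ • B) (fun _ => B) = iteratedDeriv 5 Φ (τ : ℂ) := by
  rw [← B12Taylor334.iteratedDeriv_comp_ray hs hf B hτB le_rfl, Filter.EventuallyEq.iteratedDeriv_eq 5 hagree]
  exact iteratedDeriv_comp_ofReal isOpen_ball 5 hΦ (mem_ball_self hr)

/-- **(3.54), literal left member** p. 280: for `f` of class `C⁵` on an open `s ⊇ {τB : τ ∈ [0,1]}` whose ray
function `t ↦ f(tB)` agrees near each `τ ∈ [0,1]` with a `Φ` holomorphic and bounded by `M` on `ball τ r`
(Lemma 4 + (1.18)),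
`‖∫₀¹ dτ ((1 − τ)⁴/4!) ⟨δ⁵f/δB⁵(τB), ⊗⁵B⟩‖ ≤ M / r⁵`.
[cite: Balaban1987RG1, (3.54) p.280] -/
theorem remainder334_norm_le {s : Set E} (hs : IsOpen s) {f : E → F} (hf : ContDiffOn ℝ 5 f s) (B : E)
    (hB : ∀ τ ∈ Icc (0 : ℝ) 1, τ • B ∈ s) {Φ : ℂ → F} {r M : ℝ} (hr : 0 < r)
    (hΦ : ∀ τ ∈ Icc (0 : ℝ) 1, DifferentiableOn ℂ Φ (ball (τ : ℂ) r))
    (hM : ∀ τ ∈ Icc (0 : ℝ) 1, ∀ z ∈ ball (τ : ℂ) r, ‖Φ z‖ ≤ M)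
    (hagree : ∀ τ ∈ Icc (0 : ℝ) 1, ∀ᶠ t : ℝ in 𝓝 τ, f (t • B) = Φ (t : ℂ)) :
    ‖∫ τ in (0 : ℝ)..1, ((1 - τ) ^ 4 / (4 ! : ℝ)) • iteratedFDeriv ℝ 5 f (τ • B) (fun _ => B)‖ ≤ M / r ^ 5 := by
  have heq : (∫ τ in (0 : ℝ)..1, ((1 - τ) ^ 4 / (4 ! : ℝ)) • iteratedFDeriv ℝ 5 f (τ • B) (fun _ => B))
      = ∫ τ in (0 : ℝ)..1, ((1 - τ) ^ 4 / (4 ! : ℝ)) • iteratedDeriv 5 Φ (τ : ℂ) := by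
    refine intervalIntegral.integral_congr fun τ hτ => ?_
    rw [uIcc_of_le zero_le_one] at hτ
    simp only [iteratedFDeriv_ray_eq_iteratedDeriv hs hf B hr (hB τ hτ) (hΦ τ hτ) (hagree τ hτ)]
  rw [heq]
  exact ineq354 hr hΦ hM

/-- **(3.54) literal, printed constants**: `r = α₃/‖B‖` (`B ≠ 0`), `M = E₀exp(−κd_j(X))`:
`‖∫₀¹ dτ ((1 − τ)⁴/4!) ⟨δ⁵f/δB⁵(τB), ⊗⁵B⟩‖ ≤ E₀ α₃⁻⁵ ‖B‖⁵ exp(−κd_j(X))`.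
[cite: Balaban1987RG1, (3.54) p.280] -/
theorem remainder334_norm_le_printed {s : Set E} (hs : IsOpen s) {f : E → F} (hf : ContDiffOn ℝ 5 f s) {B : E}
    (hB0 : B ≠ 0) (hB : ∀ τ ∈ Icc (0 : ℝ) 1, τ • B ∈ s) {Φ : ℂ → F} {α₃ E₀ κ d : ℝ} (hα₃ : 0 < α₃)
    (hΦ : ∀ τ ∈ Icc (0 : ℝ) 1, DifferentiableOn ℂ Φ (ball (τ : ℂ) (α₃ / ‖B‖)))
    (hM : ∀ τ ∈ Icc (0 : ℝ) 1, ∀ z ∈ ball (τ : ℂ) (α₃ / ‖B‖), ‖Φ z‖ ≤ E₀ * Real.exp (-(κ * d)))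
    (hagree : ∀ τ ∈ Icc (0 : ℝ) 1, ∀ᶠ t : ℝ in 𝓝 τ, f (t • B) = Φ (t : ℂ)) :
    ‖∫ τ in (0 : ℝ)..1, ((1 - τ) ^ 4 / (4 ! : ℝ)) • iteratedFDeriv ℝ 5 f (τ • B) (fun _ => B)‖
      ≤ E₀ * α₃⁻¹ ^ 5 * ‖B‖ ^ 5 * Real.exp (-(κ * d)) := by
  have hnB : 0 < ‖B‖ := norm_pos_iff.mpr hB0
  have h := remainder334_norm_le hs hf B hB (div_pos hα₃ hnB) hΦ hM hagree
  refine h.trans (le_of_eq ?_)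
  field_simp

/-- **(3.34) + (3.54)**: the fifth-order Taylor remainder of `f(B) = 𝐄^{(j)}(X, U_j(□₀, exp iB))` at `B = 0` —
`f(B) − Σ_{n=0}^{4} (1/n!) ⟨δⁿf/δBⁿ(0), ⊗ⁿB⟩` (the last term of (3.34), `B12Taylor334.taylor334`) — has norm
`≤ M / r⁵` under the hypotheses of `remainder334_norm_le`; with the printed constants this is
`E₀ α₃⁻⁵ |B|⁵ exp(−κd_j(X))`, «the required bound» of the form (3.35).
[cite: Balaban1987RG1, (3.34) p.277, (3.54) p.280] -/
theorem taylor5_remainder_norm_le {s : Set E} (hs : IsOpen s) {f : E → F} (hf : ContDiffOn ℝ 5 f s) (B : E)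
    (hB : ∀ τ ∈ Icc (0 : ℝ) 1, τ • B ∈ s) {Φ : ℂ → F} {r M : ℝ} (hr : 0 < r)
    (hΦ : ∀ τ ∈ Icc (0 : ℝ) 1, DifferentiableOn ℂ Φ (ball (τ : ℂ) r))
    (hM : ∀ τ ∈ Icc (0 : ℝ) 1, ∀ z ∈ ball (τ : ℂ) r, ‖Φ z‖ ≤ M)
    (hagree : ∀ τ ∈ Icc (0 : ℝ) 1, ∀ᶠ t : ℝ in 𝓝 τ, f (t • B) = Φ (t : ℂ)) :
    ‖f B - ∑ n ∈ Finset.range 5, ((n ! : ℝ)⁻¹) • iteratedFDeriv ℝ n f 0 (fun _ => B)‖ ≤ M / r ^ 5 := by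
  rw [B12Taylor334.taylor334 hs hf B hB, add_sub_cancel_left]
  exact remainder334_norm_le hs hf B hB hr hΦ hM hagree

end Ray

/-! ## 5. (3.15)–(3.17) p. 273: the `t_□`-derivative as a Cauchy integral and its estimate (v1.1) -/

section Cauchy315

/-- **(3.15)** p. 273 [PDF 25], verbatim: *«The derivative with respect to t_□, at t_□ = 0, can be written as the Cauchy
integral (1/2πi) ∫_{|t_□|=r} dt_□ (1/t_□²) 𝐄^{(j)}(X, …, …), (3.15) with the radius r given by the equality
r max{|δ𝐇_j|_X, |P₁δ𝐇_j|_X, |∇^ξ_𝐔 δ𝐇_j|_X, |Δ^ξ_𝐔 δ𝐇_j|_X} = ⅓α₂.»*  In one complex variable: for `Φ` (in the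
paper `t_□ ↦ 𝐄^{(j)}(X, exp iξ[𝐇_j(B(t)) + t_□ δ𝐇_j] 𝐔)`, analytic by (3.13)–(3.14) while the bracket obeys (3.14),
i.e. on a disc of radius `R > r`) holomorphic on `ball 0 R`, `0 < r < R`:
`Φ′(0) = (2πi)⁻¹ ∮_{|t|=r} t⁻² Φ(t) dt`.
[cite: Balaban1987RG1, (3.15) p.273] -/
theorem deriv_eq_circleIntegral_315 {Φ : ℂ → F} {r R : ℝ} (hr : 0 < r) (hrR : r < R)
    (hΦ : DifferentiableOn ℂ Φ (ball 0 R)) :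
    deriv Φ 0 = (2 * π * I)⁻¹ • ∮ t in C(0, r), (1 / (t - 0) ^ 2) • Φ t := by
  have hsub : closedBall (0 : ℂ) r ⊆ ball 0 R := closedBall_subset_ball hrR
  have hdc : DiffContOnCl ℂ Φ (ball 0 r) :=
    ⟨hΦ.mono (ball_subset_ball hrR.le),
      (hΦ.mono (closure_ball_subset_closedBall.trans hsub)).continuousOn⟩
  rw [hdc.deriv_eq_smul_circleIntegral hr, smul_smul, inv_mul_cancel₀ two_pi_I_ne_zero, one_smul]

omit [CompleteSpace F] in
/-- **(3.17), first inequality** p. 273 [PDF 25]: *«This function has the bound |(3.15)| ≦ (1/r) E₀ exp(−κd_j(X))»* —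
Cauchy's estimate for the first derivative: `Φ` holomorphic on `ball 0 R ⊋ closedBall 0 r` with `‖Φ‖ ≤ M₀` on the
circle `|t| = r` (in the paper M₀ = E₀ exp(−κd_j(X)) by (1.18), the configuration staying in the space (3.16)) gives
`‖Φ′(0)‖ ≤ M₀ / r`.
[cite: Balaban1987RG1, (3.17) p.273] -/
theorem ineq317 {Φ : ℂ → F} {r R M₀ : ℝ} (hr : 0 < r) (hrR : r < R) (hΦ : DifferentiableOn ℂ Φ (ball 0 R))
    (hM : ∀ t ∈ sphere (0 : ℂ) r, ‖Φ t‖ ≤ M₀) : ‖deriv Φ 0‖ ≤ M₀ / r := by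
  have hsub : closedBall (0 : ℂ) r ⊆ ball 0 R := closedBall_subset_ball hrR
  have hdc : DiffContOnCl ℂ Φ (ball 0 r) :=
    ⟨hΦ.mono (ball_subset_ball hrR.le),
      (hΦ.mono (closure_ball_subset_closedBall.trans hsub)).continuousOn⟩
  exact Complex.norm_deriv_le_of_forall_mem_sphere_norm_le hr hdc hM

/-- **(3.17), second inequality** p. 273 [PDF 25]: *«≦ E₀ exp(−κd_j(X)) 6α₂⁻¹ L^jη B₀B₃ exp(−½δ₀ dist^{(ξ)}(X, □) −
½δ₀ M(L^jη)⁻¹) |ζ_□𝐇_k(B′)|, (3.17) following from (3.9).»*  The arithmetic: with the radius equality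
`r · m = ⅓α₂` of (3.15) (`m` = the maximum of the four norms of δ𝐇_j, `m > 0`) and the (3.9)-type bound
`m ≤ 2s` («|δ𝐇_j| ≦ B₃ exp(…) × 2L^jη|ζ_□𝐇_k(B′)| … and the same for derivatives and the second order operators»,
`s` = L^jηB₀B₃ exp(−½δ₀dist^{(ξ)}(X,□) − ½δ₀M(L^jη)⁻¹)|ζ_□𝐇_k(B′)|), any `D ≤ M₀/r` obeys `D ≤ M₀ · 6α₂⁻¹ · s`
(the printed 6 = 3·2; cf. `B12Sec2to5.const317`).
[cite: Balaban1987RG1, (3.17) p.273, (3.9) p.271] -/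
theorem ineq317_chain {D M₀ r m α₂ s : ℝ} (hM₀ : 0 ≤ M₀) (hm : 0 < m) (hα₂ : 0 < α₂)
    (hrad : r * m = α₂ / 3) (h39 : m ≤ 2 * s) (hD : D ≤ M₀ / r) : D ≤ M₀ * (6 * α₂⁻¹ * s) := by
  have hr : r = α₂ / (3 * m) := by
    field_simp
    linarith [hrad]
  have hrpos : 0 < r := by rw [hr]; positivity
  have hinv : 1 / r = 3 * m / α₂ := by
    rw [hr]
    field_simp
  calc D ≤ M₀ / r := hD
    _ = M₀ * (3 * m / α₂) := by rw [div_eq_mul_one_div, hinv]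
    _ ≤ M₀ * (3 * (2 * s) / α₂) := by
        apply mul_le_mul_of_nonneg_left _ hM₀
        apply div_le_div_of_nonneg_right _ hα₂.le
        linarith
    _ = M₀ * (6 * α₂⁻¹ * s) := by ring

omit [CompleteSpace F] in
/-- (3.15) + (3.17) assembled: under the radius equality and the (3.9)-type bound, the `t_□`-derivative at 0 of a
function holomorphic on `ball 0 R ⊋ closedBall 0 r` and bounded by `M₀` on `|t| = r` has norm
`≤ M₀ · 6α₂⁻¹ · s`. [cite: Balaban1987RG1, (3.15)–(3.17) p.273] -/
theorem ineq317_printed {Φ : ℂ → F} {r R M₀ m α₂ s : ℝ} (hr : 0 < r) (hrR : r < R)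
    (hΦ : DifferentiableOn ℂ Φ (ball 0 R)) (hM : ∀ t ∈ sphere (0 : ℂ) r, ‖Φ t‖ ≤ M₀) (hM₀ : 0 ≤ M₀)
    (hm : 0 < m) (hα₂ : 0 < α₂) (hrad : r * m = α₂ / 3) (h39 : m ≤ 2 * s) :
    ‖deriv Φ 0‖ ≤ M₀ * (6 * α₂⁻¹ * s) :=
  ineq317_chain hM₀ hm hα₂ hrad h39 (ineq317 hr hrR hΦ hM)

end Cauchy315

end Literature.MathematicalPhysics.QuantumFieldTheory.Balaban1983to89.B12CauchyRemainder354
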